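import Literature.MathematicalPhysics.QuantumFieldTheory.Balaban1983to89.B15Claim189PinAtRecord
import Literature.MathematicalPhysics.QuantumFieldTheory.Balaban1983to89.B15Claim189FlowAtRecord
import Literature.MathematicalPhysics.QuantumFieldTheory.Balaban1983to89.B12CriticalPoint23

/-!
# `Balaban1983to89.B15Claim189PinNonVacuity` — YM-DAG node N12 · [Balaban1989LargeFieldI] CMP **122** (1989) 175–202, (1.89) p. 198 with (1.75), (1.82),
# (1.88), [III] (2.12) ∕ (2.16) ∕ (2.17): (A) THE ANTECEDENT OF (1.89) AT THE RECORD'S OBJECTS IS SATISFIABLE — def-R's (2.12) solution map of record is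
# FLAT at unit data (every `U_{k,□}(1)`, `U_{k,Z}(1)` of record has all plaquette variables `= 1`), so at the unit configuration the three
# CONCRETE remaining functions `χ_k(Ω_k^{∼4})`, `χ_{k,Λ}`, `χ_{h,1/2}` of (1.89) HOLD and `new189 (D189OfRecord θ P σ) (1, B′) ↔ χ′(B′)`: the junk
# species «(1.89) letters void» is EXACTLY the residual (1.82) letter; (B) THE (1.82) LETTER PINNED to print's instance `χ′ = χ({|B′(b)| < δ′_k,
# b ∈ 𝔹₀})` (p29's `B15Sect1ChartInstances.chiPrime182std`) on NODE 00's fluctuation carrier `ℝ^{N²−1}` with `δ′_k = g_kA₁(log g_k⁻²)^{p₁}` OF RECORD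
# (p. 183) — after which the (1.80) ∕ (1.89) binders of the [IV] displays are never vacuous

statement-level bookkeeping over published theorems with citation tags; kernel-checked compositions of tree theorems; nothing here is a claim about the Yang–Mills
mass gap.

CITATION HEADER (lean-in-tree rule).  Source: [Balaban1989LargeFieldI] («[IV]»): (1.89) p. 198 (*"with the new functions introduced in the integral, we can drop
the function χ″_k"*), (1.75) p. 193, (1.82) p. 196 (*"χ′ = χ({|B′(b)| < δ′_k for b∈𝔹₀}), and V′ = exp iB′"*), p. 183 (*"δ′_j = g_jA₁p₁(g_j), p₁(g_j) =
(log g_j⁻²)^{p₁} and p₁ < p₀"*), (1.88) p. 197; [Balaban1988Convergent] («[III]») (2.12) p. 256 (the variational problem *"for U regular … with the conditions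
M(U) = V on the determining set"*), (2.16)–(2.17) p. 257.  Seat `pub-ymgap-dag-n12-e` (YM-PLAN Track A, HUMAN RULING D-0062; director-ym R134 row N12 s3 «the
(1.80)∕(1.89) + 𝐑′ (1.99)–(1.100) p. 201 chain»), module 7 (generation 3) — the census asked for by the discharge referee dag-ref-F (READ-56 WISH, 2026-08-26:
«a kernel witness `∃ σ U, new189 (D189OfRecord θ P σ) U` is not in the tree … plausible at the unit configuration, unproved») and the complement of dag-n12-d's
junk certificate `exists_sit189_not_new189` (`Theorems/BalabanUVNodesN12ResidWPinnedLayer` §3: a situation with `χ′ :≡ ⊥` voids the (1.80)∕(1.89) binders).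
BY NAME and UNCHANGED: def-R's `Node00.SmallFieldChiOfRecord` (`UminOfRecord`, `bgOfRecord`, `isMinimizer_UminOfRecord`, `epsOfRecord`), r12's
`B15DeterminingSets` (`IsMinimizer`, `avgFamily`, `AgreeOn`, `spliceAt`), p31's `BIJ85Eq453GaugeField.qsstarGIter0` (`Q_k^{s*}`), r11's `B14.Eq216Concrete` (`chi217`,
`ukBox`, `chi217_eq_one_iff`), r11's `B15Sect1Instances` (`bgKZstd`, `chi175std_iff`), r11's `B15Eq13Concrete` (`chiHalf`, `oneOn`), r11's `B15Claim189AtInstances`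
(`new189_iff_chart`), p29's `B15Sect1ChartInstances` (`chiPrime182std`, `bondsB0`), r09's `B12CriticalPoint23.eq_one_of_reTr_eq_one_specialUnitaryGroup`, module 4
`B15Claim189PinAtRecord` (`Sit189`, `D189OfRecord`, `ResidW.pinD189`, `new189_D189OfRecord_iff`), module 5 `B15Claim189FlowAtRecord` (`epsOfRecord₁₀_pos_of_admissible`).

WHY THIS FILE.  After module 4 the antecedent of the (1.80) and (1.89) displays at a D189-pinned layer, `new189 (D189OfRecord θ P σ) U`, is the conjunction of
THREE CONCRETE functions of the configuration `U.1` at def-R's backgrounds of record — [III] (2.17) `χ_k(Ω_k^{∼4}) = 1`, (1.75) `χ_{k,Λ}`, (1.88) `χ_{h,1/2} = 1` —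
and ONE LETTER, the (1.82) function `σ.chiP U.2`.  dag-n12-d certified (kernel) that a situation with `χ′ :≡ ⊥` makes the binders vacuous; nobody had shown they
are contentful in ANY situation.  §0–§1 settle this: the concrete part HOLDS at the unit configuration in EVERY situation (positive thresholds), because
def-R's totalised (2.12) solution map returns, for the averages of the unit configuration, a minimiser of the Wilson action among configurations with those
averages — the unit configuration is admissible with action `0`, so the chosen minimiser has action `0`, and on `SU(N)` zero action forces every plaquette
variable to be `1` (r09's `Re tr g = 1 ⇒ g = 1`).  Hence `new189 (D189OfRecord θ P σ) (1, B′) ↔ σ.chiP B′` and `(∀ U, ¬ new189 …) ↔ (∀ B′, ¬ σ.chiP B′)`: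
the junk species is exactly the (1.82) letter.  §2 then PINS that letter to print's instance (p29's `chiPrime182std`, read at the situation's own regions and
levels, NODE 00's fluctuation carrier `EuclideanSpace ℝ (Fin (N²−1))` = `Node00.FluctV N` verbatim, and `δ′_k` OF RECORD from `θ.A₁` and the run's coupling):
with `δ′_k > 0` (in the window) the pinned antecedent holds at `(1, 0)`, so no situation family with print's `χ′` reproduces the junk certificate.

WHAT THIS FILE PROVES (0 `sorry`; data defs `Node00.Sit189.pinChi182`, `Node00.ResidW.pinD189χ`, the census witness `unitSit189`, one numeric of record `deltaPrimeOfRecord`).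
§0 def-R's solution map at unit data (generic lattice `P`, gauge group `G`; the flatness step on `SU(N)`): `qsstarGIter0_one`, `wilsonAction4_unit`,
   `isMinimizer_one_avgFamily_one`, `wilsonAction4_eq_zero_of_isMinimizer_avgFamily_one` ∕ `plaqHol_eq_one_of_isMinimizer_avgFamily_one` (selector-independent:
   any minimiser of the unit data — also node00-def-K0c's measurable selector `UminSelOfRecord`, same `IsMinimizer` interface, bus INTENT-0 2026-08-26T22:18Z),
   `wilsonAction4_UminOfRecord_avgFamily_one`, `plaqHol_eq_one_of_wilsonAction4_eq_zero`, `plaqHol_UminOfRecord_avgFamily_one`,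
   `plaqSmallOn_UminOfRecord_avgFamily_one`, `plaqSmallOn_bgOfRecord_U_qsstar_one`, `one_mem_plaqSmall`, `oneOn_one`.
§1 at the record, `V ≡ 1`: `chi217_bgOfRecord_one`, `chi175std_bgOfRecord_one`, `chiHalf_bgOfRecord_one`, **`new189_D189OfRecord_one_iff`**,
   **`forall_not_new189_D189OfRecord_iff`** (the junk species = the χ′ letter), `exists_new189_D189OfRecord_of_chiP` (ref-F's WISH), `unitSit189` ∕ `new189_unitSit189_one` ∕
   `exists_sit189_new189_D189OfRecord` (even module 4's degenerate inhabitant is NOT void), `new189_D189OfRecord_one_iff_of_admissible` (thresholds read off admissibility + the window).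
§2 the (1.82) pin: `deltaPrimeOfRecord` (+ `_pos`, `_pos_of_inInterval`), `Sit189.pinChi182` (+ `rfl` faces, `pinChi182_chiP_iff`, `chiP_pinChi182_zero`),
   `new189_D189OfRecord_pinChi182_iff` (ALL FOUR remaining functions concrete — r11's `new189_iff_chart` by name), **`new189_D189OfRecord_pinChi182_one_zero`**,
   `exists_new189_D189OfRecord_pinChi182`, `not_forall_not_new189_pinChi182`; `ResidW.pinD189χ` (+ `rfl` faces, `pinD189χ_pinRPrime_comm`),
   `new189_pinD189χ_one_zero_of_admissible`.

LOCATED (unchanged from module 4 (i)–(iv); nothing asserted): the regions, cube families, numbers and deviation letters of `σ` stay residual — one (1.89) situation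
per run is the W pin's granularity while print has one per term of (2.18) (NODE 00 carrier design); print's exponent `p₁` (*"other conditions on p₁ will be
formulated later"*, p. 183) is not a numeric of the record and enters `deltaPrimeOfRecord` as a parameter.

HONEST FRAMING.  Count-neutral: kernel bookkeeping (a variational triviality at unit data) + one data transformer + r11 ∕ p29 junctions by name; NO estimate of
Bałaban's asserted; N12 NOT discharged; one finite four-torus programme at fixed `ε`, Bałaban AS PRINTED with locators; nothing continuum ∕ ℝ⁴ ∕ OS ∕ mass gap ∕
Clay.  No `sorry`, no `axiom`, no `instance`, no `notation`.
-/

noncomputable section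

open scoped BigOperators
open MeasureTheory

namespace Literature.MathematicalPhysics.QuantumFieldTheory.Balaban1983to89

namespace B15Claim189PinNonVacuity

open DagBinding T4Continuum Node00
open B15DeterminingSets (MSField DetBackground DetSet IsMinimizer avgFamily AgreeOn spliceAt pts)
open B14.Eq216Concrete (chi217 ukBox)
open B15Eq13Concrete (chiHalf oneOn)
open B15Sect1Instances (bgKZstd chi175std)
open B15Claim189Assembly (Setting189 new189)
open B15Claim189PinAtRecord (D189OfRecord new189_D189OfRecord_iff)
open B15Sect1ChartInstances (chiPrime182std bondsB0)
open BalabanImbrieJaffe1984to88.BIJ85Eq453GaugeField (qsstarGIter0 qsstarG qsstarGIter0_succ)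
open GaugeGroup (dist1 reTr)
open GaugeField (plaqHol)

/-! ## §0. def-R's (2.12) solution map of record at UNIT DATA: the chosen minimiser has zero action, hence (on `SU(N)`) all plaquette variables `= 1` -/

section SolutionMapAtOne

variable {P : Params} {G : Type*} [GaugeGroup G]

/-- `Q_k^{s*}` of the unit configuration is the unit configuration (both branches of p31's (4.5.3) are `1`). [cite: BalabanImbrieJaffe1985, (4.5.3) p.312 (bookkeeping)] -/
theorem qsstarGIter0_one : ∀ k : ℕ, qsstarGIter0 k (1 : GaugeField P k G) = 1
  | 0 => rfl
  | k + 1 => by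
    rw [qsstarGIter0_succ]
    have h1 : qsstarG (1 : GaugeField P (k + 1) G) = (1 : GaugeField P k G) := by
      funext b; unfold qsstarG; split_ifs <;> rfl
    rw [h1, qsstarGIter0_one k]

/-- The unit configuration has zero Wilson action (`1(∂p) = 1`, `Re tr 1 = 1`). [cite: Balaban1987RG1, (0.2) p.252 (bookkeeping)] -/
theorem wilsonAction4_unit (j : ℕ) : wilsonAction4 (1 : GaugeField P j G) = 0 := by
  unfold wilsonAction4 wilsonAction
  simp [B15Chi124DetSets.plaqHol_one, GaugeGroup.reTr_one]

/-- **THE UNIT CONFIGURATION MINIMISES (2.12) FOR ITS OWN AVERAGES** on EVERY determining set, in every regularity class containing it: the constraint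
`M_𝐁(U) = M_𝐁(1)` holds for `U = 1` trivially and the Wilson action is nonnegative with `A(1) = 0`. [cite: Balaban1988Convergent, (2.12) p.256] -/
theorem isMinimizer_one_avgFamily_one (av : ∀ j, Averaging P j G) {reg : Set (GaugeField P 0 G)} (h1 : (1 : GaugeField P 0 G) ∈ reg) (𝔹 : DetSet P) :
    IsMinimizer av reg 𝔹 (avgFamily av 1) 1 := by
  refine ⟨h1, fun _ _ _ => rfl, fun U _ _ => ?_⟩
  rw [wilsonAction4_unit]
  exact wilsonAction4_nonneg U

/-- **EVERY MINIMISER OF (2.12) AT UNIT DATA HAS ZERO ACTION** (selector-independent: holds for def-R's `UminOfRecord` below and verbatim for any other selection of a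
minimiser, e.g. node00-def-K0c's measurable selector with the same `IsMinimizer` interface): its action is `≤ A(1) = 0` and `≥ 0`. [cite: Balaban1988Convergent, (2.12) p.256] -/
theorem wilsonAction4_eq_zero_of_isMinimizer_avgFamily_one (av : ∀ j, Averaging P j G) {reg : Set (GaugeField P 0 G)} (h1 : (1 : GaugeField P 0 G) ∈ reg)
    {𝔹 : DetSet P} {U₀ : GaugeField P 0 G} (hU : IsMinimizer av reg 𝔹 (avgFamily av 1) U₀) : wilsonAction4 U₀ = 0 := by
  have hle : wilsonAction4 U₀ ≤ wilsonAction4 (1 : GaugeField P 0 G) := hU.2.2 1 h1 (fun _ _ _ => rfl)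
  rw [wilsonAction4_unit] at hle
  exact le_antisymm hle (wilsonAction4_nonneg _)

/-- **def-R's CHOSEN SOLUTION AT UNIT DATA HAS ZERO ACTION**: the data `M˙(1)` is solvable (by `1`), so `UminOfRecord` is a minimiser (`isMinimizer_UminOfRecord`).
[cite: Balaban1988Convergent, (2.12) p.256] -/
theorem wilsonAction4_UminOfRecord_avgFamily_one [MeasurableSpace G] (av : ∀ j, Averaging P j G) {reg : Set (GaugeField P 0 G)}
    (h1 : (1 : GaugeField P 0 G) ∈ reg) (𝔹 : DetSet P) : wilsonAction4 (UminOfRecord av reg 𝔹 (avgFamily av 1)) = 0 :=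
  -- v1.1 (K0c g3 one-off, REBALANCE №62 S4): ONE instance binder `[MeasurableSpace G]` — the signature def-R's `UminOfRecord` carries under FILE 1 v2′ (director-ym №128 D1 (B)).
  wilsonAction4_eq_zero_of_isMinimizer_avgFamily_one av h1 (isMinimizer_UminOfRecord av reg ⟨1, isMinimizer_one_avgFamily_one av h1 𝔹⟩)

/-- **ON `SU(N)`, ZERO WILSON ACTION FORCES EVERY PLAQUETTE VARIABLE TO BE `1`**: the action is a sum of the nonnegative terms `1 − Re tr U(∂p)`, and `Re tr g = 1`
only at `g = 1` (r09's `B12CriticalPoint23.eq_one_of_reTr_eq_one_specialUnitaryGroup`). [cite: Balaban1987RG1, (0.2) p.252; BrockerTomDieck1985, IV (3.1)] -/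
theorem plaqHol_eq_one_of_wilsonAction4_eq_zero {N : ℕ} [NeZero N] {j : ℕ} (U : GaugeField P j (SU N)) (hA : wilsonAction4 U = 0) (p : Plaq P j) :
    plaqHol U p = 1 := by
  unfold wilsonAction4 wilsonAction at hA
  have hnn : ∀ q ∈ (Finset.univ : Finset (Plaq P j)), 0 ≤ 1 * (1 - reTr (plaqHol U q)) := fun q _ => by
    have := GaugeGroup.reTr_le_one (plaqHol U q)
    rw [one_mul]; linarith
  have hp := (Finset.sum_eq_zero_iff_of_nonneg hnn).1 hA p (Finset.mem_univ p)
  rw [one_mul, sub_eq_zero] at hp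
  exact B12CriticalPoint23.eq_one_of_reTr_eq_one_specialUnitaryGroup _ hp.symm

/-- **EVERY MINIMISER OF (2.12) AT UNIT DATA IS FLAT** (`SU(N)`; selector-independent form). [cite: Balaban1988Convergent, (2.12) p.256] -/
theorem plaqHol_eq_one_of_isMinimizer_avgFamily_one {N : ℕ} [NeZero N] (av : ∀ j, Averaging P j (SU N)) {reg : Set (GaugeField P 0 (SU N))}
    (h1 : (1 : GaugeField P 0 (SU N)) ∈ reg) {𝔹 : DetSet P} {U₀ : GaugeField P 0 (SU N)} (hU : IsMinimizer av reg 𝔹 (avgFamily av 1) U₀) (p : Plaq P 0) :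
    plaqHol U₀ p = 1 :=
  plaqHol_eq_one_of_wilsonAction4_eq_zero _ (wilsonAction4_eq_zero_of_isMinimizer_avgFamily_one av h1 hU) p

/-- **def-R's CHOSEN SOLUTION AT UNIT DATA IS FLAT** (`SU(N)`): every plaquette variable of `UminOfRecord av reg 𝐁 M˙(1)` is `1`, for every determining set and every
regularity class containing `1`. [cite: Balaban1988Convergent, (2.12) p.256] -/
theorem plaqHol_UminOfRecord_avgFamily_one {N : ℕ} [NeZero N] (av : ∀ j, Averaging P j (SU N)) {reg : Set (GaugeField P 0 (SU N))}
    (h1 : (1 : GaugeField P 0 (SU N)) ∈ reg) (𝔹 : DetSet P) (p : Plaq P 0) : plaqHol (UminOfRecord av reg 𝔹 (avgFamily av 1)) p = 1 :=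
  plaqHol_eq_one_of_wilsonAction4_eq_zero _ (wilsonAction4_UminOfRecord_avgFamily_one av h1 𝔹) p

/-- … hence it satisfies every small-plaquette condition with a positive threshold on every plaquette set (`|1 − 1| = 0 < δ`). [cite: Balaban1988Convergent, (1.4) p.247, (2.12) p.256] -/
theorem plaqSmallOn_UminOfRecord_avgFamily_one {N : ℕ} [NeZero N] (av : ∀ j, Averaging P j (SU N)) {reg : Set (GaugeField P 0 (SU N))}
    (h1 : (1 : GaugeField P 0 (SU N)) ∈ reg) (𝔹 : DetSet P) (S : Set (Plaq P 0)) {δ : ℝ} (hδ : 0 < δ) :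
    PlaqSmallOn S δ (UminOfRecord av reg 𝔹 (avgFamily av 1)) := by
  intro p _
  rw [plaqHol_UminOfRecord_avgFamily_one av h1 𝔹 p, GaugeGroup.dist1_one]
  exact hδ

/-- **THE (2.16)∕(1.74)-TYPE BACKGROUNDS OF RECORD AT THE UNIT CONFIGURATION ARE FLAT**: `U(𝐁, M˙(Q_k^{s*}1))` of def-R's datum of record `bgOfRecord av reg` —
the shape of r11's `ukBox … k 1` and `bgKZstd … k 1` — satisfies every positive small-plaquette condition. [cite: Balaban1988Convergent, (2.16) p.257; Balaban1989LargeFieldI, (1.74) p.192] -/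
theorem plaqSmallOn_bgOfRecord_U_qsstar_one {N : ℕ} [NeZero N] (av : ∀ j, Averaging P j (SU N)) {reg : Set (GaugeField P 0 (SU N))}
    (h1 : (1 : GaugeField P 0 (SU N)) ∈ reg) (𝔹 : DetSet P) (k : ℕ) (S : Set (Plaq P 0)) {δ : ℝ} (hδ : 0 < δ) :
    PlaqSmallOn S δ ((bgOfRecord av reg).U 𝔹 (avgFamily av (qsstarGIter0 k (1 : GaugeField P k (SU N))))) := by
  rw [qsstarGIter0_one, bgOfRecord_U]
  exact plaqSmallOn_UminOfRecord_avgFamily_one av h1 𝔹 S hδ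

/-- The unit configuration lies in a small-plaquette regularity class `{U | |U(∂p) − 1| < δ}` exactly when… it suffices that `δ > 0`. [cite: Balaban1988Convergent, (2.12) p.256 («U regular»)] -/
theorem one_mem_plaqSmall {j : ℕ} {δ : ℝ} (hδ : 0 < δ) : (1 : GaugeField P j G) ∈ {U : GaugeField P j G | PlaqSmall δ U} := by
  intro p
  rw [B15Chi124DetSets.plaqHol_one, GaugeGroup.dist1_one]
  exact hδ

/-- `(1, V_h)` of (1.88) at `V_h = 1` is the unit configuration (both pieces of the splice are `1`). [cite: Balaban1989LargeFieldI, (1.88) p.198 (bookkeeping)] -/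
theorem oneOn_one (ΩppT2 : Set (Site P 0)) (h : ℕ) : oneOn ΩppT2 h (1 : GaugeField P h G) = 1 := by
  funext b
  unfold oneOn spliceAt
  split_ifs <;> rfl

end SolutionMapAtOne

/-! ## §1. AT THE RECORD, `V ≡ 1`: the three concrete remaining functions of (1.89) HOLD; the antecedent is void iff the (1.82) letter is -/

section AtRecord

variable {F : T4Family} {N : ℕ} [NeZero N]

/-! `0 < η_j` is the tree's `BIJ85Sigma422Eta.eta_pos`; to keep the imports on the [IV] chain it is used below in its one-line form
`pow_pos (inv_pos.mpr P.cast_L_pos) j : 0 < P.eta j`. -/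

/-- **[III] (2.17) `χ_k(Ω_k^{∼4}) = 1` AT `V_k = 1` for def-R's datum of record**, any cube family, threshold `ε_kη_k² > 0`, `1` regular. [cite: Balaban1988Convergent, (2.16)–(2.17) p.257] -/
theorem chi217_bgOfRecord_one {K : ℕ} (reg : Set (GaugeField (F.P K) 0 (SU N))) (h1 : (1 : GaugeField (F.P K) 0 (SU N)) ∈ reg) (M₁ : ℕ)
    {ι : Type*} (X : Finset ι) (plaqT : ι → Set (Plaq (F.P K) 0)) (enl4 : ι → Set (Site (F.P K) 0)) {εk : ℝ} (hε : 0 < εk) (k : ℕ) :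
    chi217 (bgOfRecord (avOfRecord F N K) reg) M₁ X plaqT enl4 εk k (1 : GaugeField (F.P K) k (SU N)) = 1 := by
  rw [B14.Eq216Concrete.chi217_eq_one_iff]
  intro c _
  rw [B14.Eq216Concrete.ukBox_apply]
  exact plaqSmallOn_bgOfRecord_U_qsstar_one _ h1 _ k _ (mul_pos hε (pow_pos (pow_pos (inv_pos.mpr (F.P K).cast_L_pos) k) 2))

/-- **(1.75) `χ_{k,Λ}` AT `V_k = 1` for def-R's datum of record**: the extension `W := 1` of `1↾_{Z∩Λᶜ}` has `U_{k,Z}(1)` flat, so `|U_{k,Z}(∂p) − 1| = 0 < 2ε_kη²`.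
[cite: Balaban1989LargeFieldI, (1.74)–(1.75) pp.192–193] -/
theorem chi175std_bgOfRecord_one {K : ℕ} (reg : Set (GaugeField (F.P K) 0 (SU N))) (h1 : (1 : GaugeField (F.P K) 0 (SU N)) ∈ reg) (M₁ : ℕ)
    (Z Λ : Set (Site (F.P K) 0)) (k : ℕ) (Ω : ℕ → Set (Site (F.P K) 0)) {εk η : ℝ} (hε : 0 < εk) (hη : 0 < η) :
    chi175std (bgOfRecord (avOfRecord F N K) reg) M₁ Z Λ k Ω εk η (1 : GaugeField (F.P K) k (SU N)) := by
  rw [B15Sect1Instances.chi175std_iff]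
  refine ⟨1, fun _ _ => rfl, ?_⟩
  rw [B15Sect1Instances.bgKZstd_apply]
  exact plaqSmallOn_bgOfRecord_U_qsstar_one _ h1 _ k _ (mul_pos (mul_pos two_pos hε) (pow_pos hη 2))

/-- **(1.88) `χ_{h,1/2} = 1` AT `V_h = 1` for def-R's datum of record**: `(1, 1) = 1` and `U_{h,□}(1)` is flat. [cite: Balaban1989LargeFieldI, (1.88) pp.197–198] -/
theorem chiHalf_bgOfRecord_one {K : ℕ} (reg : Set (GaugeField (F.P K) 0 (SU N))) (h1 : (1 : GaugeField (F.P K) 0 (SU N)) ∈ reg) (M₁ : ℕ)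
    {ι : Type*} (X : Finset ι) (plaqT : ι → Set (Plaq (F.P K) 0)) (enl4 : ι → Set (Site (F.P K) 0)) {ε : ℕ → ℝ} (h : ℕ) (hε : 0 < ε h)
    (ΩppT2 : Set (Site (F.P K) 0)) :
    chiHalf (bgOfRecord (avOfRecord F N K) reg) M₁ X plaqT enl4 ε h ΩppT2 (1 : GaugeField (F.P K) h (SU N)) = 1 := by
  classical
  unfold chiHalf
  refine Finset.prod_eq_one fun c _ => ?_
  have hsmall : PlaqSmallOn (plaqT c) (1 / 2 * ε h * (F.P K).eta h ^ 2)
      (ukBox (bgOfRecord (avOfRecord F N K) reg) M₁ (enl4 c) h (oneOn ΩppT2 h (1 : GaugeField (F.P K) h (SU N)))) := by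
    rw [oneOn_one, B14.Eq216Concrete.ukBox_apply]
    exact plaqSmallOn_bgOfRecord_U_qsstar_one _ h1 _ h _ (mul_pos (mul_pos (by norm_num) hε) (pow_pos (pow_pos (inv_pos.mpr (F.P K).cast_L_pos) h) 2))
  unfold chiSmall
  rw [if_pos hsmall]

variable (θ : Stage9Params F N) (P : B12.RunParams) (σ : Sit189 F N P.K)

/-- **THE ANTECEDENT OF (1.89) AT THE RECORD'S OBJECTS, AT THE UNIT CONFIGURATION, IS THE (1.82) LETTER**: with positive thresholds `ε_k`, `ε_h` of record and a
positive regularity threshold `εreg` (so `1` is regular), `new189 (D189OfRecord θ P σ) (1, B′) ↔ σ.chiP B′` — the three concrete remaining functions hold at `1`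
(§0–§1), the letter is what is left (`σ.h ≤ σ.k`). [cite: Balaban1989LargeFieldI, (1.89) p.198, (1.75) p.193, (1.82) p.196, (1.88) p.197; Balaban1988Convergent, (2.12) p.256, (2.17) p.257] -/
theorem new189_D189OfRecord_one_iff (hhk : σ.h ≤ σ.k) (hreg : 0 < θ.ν.εreg) (hεk : 0 < epsOfRecord θ.ν (gOfRecord₁₀ F N θ P) σ.k)
    (hεh : 0 < epsOfRecord θ.ν (gOfRecord₁₀ F N θ P) σ.h) (B' : (j : ℕ) → VecField (F.P P.K) j σ.𝔤) :
    new189 (D189OfRecord θ P σ) ((1 : MSField (F.P P.K) (SU N)), B') ↔ σ.chiP B' := by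
  have h1 : (1 : GaugeField (F.P P.K) 0 (SU N)) ∈ {U : GaugeField (F.P P.K) 0 (SU N) | PlaqSmall (θ.ν.εreg * (F.P P.K).eta σ.k ^ 2) U} :=
    one_mem_plaqSmall (mul_pos hreg (pow_pos (pow_pos (inv_pos.mpr (F.P P.K).cast_L_pos) σ.k) 2))
  rw [new189_D189OfRecord_iff θ P σ hhk]
  constructor
  · rintro ⟨_, _, _, hχ⟩
    exact hχ
  · intro hχ
    exact ⟨chi217_bgOfRecord_one _ h1 _ _ _ _ hεk σ.k, chi175std_bgOfRecord_one _ h1 _ _ _ σ.k _ hεk (pow_pos (inv_pos.mpr (F.P P.K).cast_L_pos) σ.k),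
      chiHalf_bgOfRecord_one _ h1 _ _ _ _ σ.h hεh _, hχ⟩

/-- **CENSUS — THE JUNK SPECIES OF THE D189 PIN IS EXACTLY THE (1.82) LETTER**: the (1.80)∕(1.89) binders `∀ U, new189 (D189OfRecord θ P σ) U → …` are vacuous iff
`χ′` is never satisfied (positive thresholds, `σ.h ≤ σ.k`; the ← direction is unconditional: `χ′(U.2)` is the fourth conjunct of `new189`). dag-n12-d's certificate
(`χ′ :≡ ⊥`) is the only way. [cite: Balaban1989LargeFieldI, (1.89) p.198, (1.82) p.196 (bookkeeping census)] -/
theorem forall_not_new189_D189OfRecord_iff (hhk : σ.h ≤ σ.k) (hreg : 0 < θ.ν.εreg) (hεk : 0 < epsOfRecord θ.ν (gOfRecord₁₀ F N θ P) σ.k)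
    (hεh : 0 < epsOfRecord θ.ν (gOfRecord₁₀ F N θ P) σ.h) :
    (∀ U, ¬ new189 (D189OfRecord θ P σ) U) ↔ ∀ B' : (j : ℕ) → VecField (F.P P.K) j σ.𝔤, ¬ σ.chiP B' := by
  constructor
  · intro h B' hχ
    exact h (1, B') ((new189_D189OfRecord_one_iff θ P σ hhk hreg hεk hεh B').2 hχ)
  · intro h U hU
    exact h U.2 ((new189_D189OfRecord_iff θ P σ hhk U).1 hU).2.2.2

/-- The unconditional half of the census: a satisfied antecedent certifies the (1.82) letter at `U.2`. [cite: Balaban1989LargeFieldI, (1.89) p.198, (1.82) p.196 (bookkeeping)] -/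
theorem chiP_of_new189_D189OfRecord (hhk : σ.h ≤ σ.k) {U : MSField (F.P P.K) (SU N) × ((j : ℕ) → VecField (F.P P.K) j σ.𝔤)}
    (hU : new189 (D189OfRecord θ P σ) U) : σ.chiP U.2 :=
  ((new189_D189OfRecord_iff θ P σ hhk U).1 hU).2.2.2

/-- **ref-F's WISH — THE PINNED (1.89) ANTECEDENT IS SATISFIABLE in every situation whose (1.82) letter is**: `(∃ B′, χ′(B′)) ⇒ ∃ U, new189 (D189OfRecord θ P σ) U`
(witness `U = (1, B′)`). [cite: Balaban1989LargeFieldI, (1.89) p.198 (bookkeeping witness)] -/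
theorem exists_new189_D189OfRecord_of_chiP (hhk : σ.h ≤ σ.k) (hreg : 0 < θ.ν.εreg) (hεk : 0 < epsOfRecord θ.ν (gOfRecord₁₀ F N θ P) σ.k)
    (hεh : 0 < epsOfRecord θ.ν (gOfRecord₁₀ F N θ P) σ.h) (hχ : ∃ B', σ.chiP B') :
    ∃ U, new189 (D189OfRecord θ P σ) U := by
  obtain ⟨B', hB'⟩ := hχ
  exact ⟨(1, B'), (new189_D189OfRecord_one_iff θ P σ hhk hreg hεk hεh B').2 hB'⟩

variable (F N) in
/-- Module 4's DEGENERATE situation made a definition (the literal of `nonempty_sit189`: trivial chart carrier, `χ′ :≡ ⊤`, levels `0`, empty regions and cube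
families, all numbers `0`, zero deviation letters; NOT objects of record) — used only as a census witness below. [cite: Balaban1989LargeFieldI, (1.89) p.198 (bookkeeping witness)] -/
def unitSit189 (K : ℕ) : Sit189 F N K :=
  { 𝔤 := PUnit, chiP := fun _ => True, h := 0, k₀ := 0, k := 0, sh := 0, sk := 0, Ω := fun _ => ∅, Zpp := fun _ => ∅, Z := ∅, Λ := ∅, OmT := ∅, ΩppT2 := ∅,
    β := 0, L₀ := 0, α := 0, δ := 0, B₃ := 0, B₅ := 0, M := 0, O1 := 0, dist := fun _ => 0, Xhalf := ∅, XH := ∅, XΩ4 := ∅, boxOf := fun _ _ => 0,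
    devV'' := fun _ _ => 0, dev97 := fun _ _ => 0, dev0 := fun _ _ => 0 }

variable {θ P} in
/-- Even module 4's DEGENERATE situation (`nonempty_sit189` ∕ `unitSit189`: levels `0`, empty regions, `χ′ :≡ ⊤`) does NOT void the binders: at the unit configuration its
antecedent holds (threshold `ε_0 > 0`, `εreg > 0`) — ref-F's reading «plausible at the unit configuration» made kernel. [cite: Balaban1989LargeFieldI, (1.89) p.198 (bookkeeping witness)] -/
theorem new189_unitSit189_one (hreg : 0 < θ.ν.εreg) (hε0 : 0 < epsOfRecord θ.ν (gOfRecord₁₀ F N θ P) 0) (B' : (j : ℕ) → VecField (F.P P.K) j PUnit) :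
    new189 (D189OfRecord θ P (unitSit189 F N P.K)) ((1 : MSField (F.P P.K) (SU N)), B') :=
  (new189_D189OfRecord_one_iff θ P (unitSit189 F N P.K) le_rfl hreg hε0 hε0 B').2 trivial

variable {θ P} in
/-- … so SOME situation has a satisfied antecedent at the record's objects (ref-F's `∃ σ U, new189 (D189OfRecord θ P σ) U`, positive `εreg`, `ε_0`).
[cite: Balaban1989LargeFieldI, (1.89) p.198 (bookkeeping witness)] -/
theorem exists_sit189_new189_D189OfRecord (hreg : 0 < θ.ν.εreg) (hε0 : 0 < epsOfRecord θ.ν (gOfRecord₁₀ F N θ P) 0) :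
    ∃ (σ : Sit189 F N P.K) (U : MSField (F.P P.K) (SU N) × ((j : ℕ) → VecField (F.P P.K) j σ.𝔤)), new189 (D189OfRecord θ P σ) U :=
  ⟨unitSit189 F N P.K, (1, fun _ _ => PUnit.unit), new189_unitSit189_one hreg hε0 _⟩

variable {θ} in
/-- **AT ADMISSIBLE PARAMETERS IN THE WINDOW the sign inputs are theorems**: `0 < εreg` is a clause of admissibility (def-R's PLUG-RECIPE-7) and `0 < ε_j` for `j ≦ n` along a
history in `]0, γ]`, `γ < 1` (module 5's `epsOfRecord₁₀_pos_of_admissible`); so for a situation with levels `σ.h ≤ σ.k ≤ n` the antecedent at `(1, B′)` IS `χ′(B′)`.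
[cite: Balaban1988Convergent, (2.4) p.255, (2.12) p.256; Balaban1989LargeFieldI, (1.89) p.198] -/
theorem new189_D189OfRecord_one_iff_of_admissible (hθ : θ.Admissible) (hγ1 : θ.γ < 1) {n : ℕ} (hI : Step.InInterval θ.γ n (gOfRecord₁₀ F N θ P))
    (hhk : σ.h ≤ σ.k) (hkn : σ.k ≤ n) (B' : (j : ℕ) → VecField (F.P P.K) j σ.𝔤) :
    new189 (D189OfRecord θ P σ) ((1 : MSField (F.P P.K) (SU N)), B') ↔ σ.chiP B' :=
  new189_D189OfRecord_one_iff θ P σ hhk hθ.1.1.2.2.1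
    (B15Claim189FlowAtRecord.epsOfRecord₁₀_pos_of_admissible hθ hγ1 P hI σ.k hkn)
    (B15Claim189FlowAtRecord.epsOfRecord₁₀_pos_of_admissible hθ hγ1 P hI σ.h (hhk.trans hkn)) B'

end AtRecord

/-! ## §2. THE (1.82) LETTER PINNED to print's instance `χ′ = χ({|B′(b)| < δ′_k, b ∈ 𝔹₀})` with `δ′_k` OF RECORD -/

section DeltaPrime

variable {F : T4Family} {N : ℕ} [NeZero N]

variable (F N) in
/-- **`δ′_j` OF RECORD**: p. 183, verbatim: *"δ′_j = g_jA₁p₁(g_j), p₁(g_j) = (log g_j⁻²)^{p₁} and p₁ < p₀"* — along the run's coupling history `g_j = gOfRecord₁₀ θ P j` with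
the record's `A₁` (`Stage9Params.A₁`, the constant of [I] (1.16) ∕ [III] (3.4)) and print's exponent `p₁` (a parameter: *"other conditions on p₁ will be formulated
later"*; not a numeric of the record); `p0Profile A p g = A(log g⁻²)^p`. [cite: Balaban1989LargeFieldI, (1.27) p.182, p.183] -/
def deltaPrimeOfRecord (θ : Stage9Params F N) (P : B12.RunParams) (p₁ : ℕ) (j : ℕ) : ℝ :=
  gOfRecord₁₀ F N θ P j * p0Profile θ.A₁ p₁ (gOfRecord₁₀ F N θ P j)

/-- Unfolding: `δ′_j = g_j · A₁ · (log (g_j²)⁻¹)^{p₁}`. [cite: Balaban1989LargeFieldI, p.183 (bookkeeping)] -/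
theorem deltaPrimeOfRecord_eq (θ : Stage9Params F N) (P : B12.RunParams) (p₁ j : ℕ) :
    deltaPrimeOfRecord F N θ P p₁ j = gOfRecord₁₀ F N θ P j * (θ.A₁ * (Real.log (gOfRecord₁₀ F N θ P j ^ 2)⁻¹) ^ p₁) := rfl

/-- `δ′_j > 0` for a coupling in `]0, 1[` and `A₁ > 0` (`log g⁻² > 0`). [cite: Balaban1989LargeFieldI, p.183; Balaban1988Convergent, (3.4) p.265 (`δ_k > 0`)] -/
theorem deltaPrimeOfRecord_pos (θ : Stage9Params F N) (P : B12.RunParams) (p₁ : ℕ) {j : ℕ} (hA₁ : 0 < θ.A₁) (hg₀ : 0 < gOfRecord₁₀ F N θ P j)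
    (hg₁ : gOfRecord₁₀ F N θ P j < 1) : 0 < deltaPrimeOfRecord F N θ P p₁ j := by
  unfold deltaPrimeOfRecord p0Profile
  have hsq : gOfRecord₁₀ F N θ P j ^ 2 < 1 := by nlinarith
  have hlog : 0 < Real.log (gOfRecord₁₀ F N θ P j ^ 2)⁻¹ := Real.log_pos ((one_lt_inv₀ (pow_pos hg₀ 2)).mpr hsq)
  exact mul_pos hg₀ (mul_pos hA₁ (pow_pos hlog _))

/-- … in particular along a history in the window `]0, γ]`, `γ < 1`, for every `j ≦ n`. [cite: Balaban1989LargeFieldI, p.183; Balaban1987RG1, Thm 1 p.259] -/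
theorem deltaPrimeOfRecord_pos_of_inInterval (θ : Stage9Params F N) (P : B12.RunParams) (p₁ : ℕ) (hA₁ : 0 < θ.A₁) {γ : ℝ} (hγ1 : γ < 1) {n : ℕ}
    (hI : Step.InInterval γ n (gOfRecord₁₀ F N θ P)) {j : ℕ} (hj : j ≤ n) : 0 < deltaPrimeOfRecord F N θ P p₁ j :=
  deltaPrimeOfRecord_pos θ P p₁ hA₁ (hI j hj).1 ((hI j hj).2.trans_lt hγ1)

end DeltaPrime

section Pin

variable {F : T4Family} {N : ℕ} [NeZero N]

/-- **THE (1.89) SITUATION WITH ITS (1.82) LETTER PINNED TO PRINT'S INSTANCE**: chart carrier := NODE 00's fluctuation carrier `ℝ^{N²−1}` (`EuclideanSpace ℝ (Fin (N²−1))`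
= `Node00.FluctV N` verbatim — the carrier in which NODE 00's 𝐓-weights test `|B(b)| < δ_j`), `χ′ := chiPrime182std` of p29 read at the situation's own regions
`Ω, Z″, Z, Λ, Ω″^{∼2}_{h+1}`, levels `h, k`, and a threshold `δ′`: *"χ′ = χ({|B′(b)| < δ′_k for b∈𝔹₀})"*, `𝔹₀ = 𝔹″_k∩Λ₀`, `Λ₀ = Λ∩Ω″^{∼2}_{h+1}` (p. 195 bond
convention inside `bondsB0`); everything else unchanged.  Data, no law. [cite: Balaban1989LargeFieldI, (1.82) p.196, (1.81) p.195] -/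
def _root_.Literature.MathematicalPhysics.QuantumFieldTheory.Balaban1983to89.Node00.Sit189.pinChi182 {K : ℕ} (σ : Sit189 F N K) (δ' : ℝ) : Sit189 F N K :=
  { σ with
    𝔤 := EuclideanSpace ℝ (Fin (N ^ 2 - 1))
    chiP := fun B' => chiPrime182std σ.Ω σ.Zpp σ.Z σ.Λ σ.ΩppT2 σ.h σ.k δ' B' }

variable {K : ℕ} (σ : Sit189 F N K) (δ' : ℝ)

/-- The pin keeps the levels (`rfl` ×3). [cite: Balaban1989LargeFieldI, (1.24) p.181 (bookkeeping)] -/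
theorem pinChi182_levels : (σ.pinChi182 δ').h = σ.h ∧ (σ.pinChi182 δ').k₀ = σ.k₀ ∧ (σ.pinChi182 δ').k = σ.k := ⟨rfl, rfl, rfl⟩

/-- The pin keeps the regions (`rfl` ×6). [cite: Balaban1989LargeFieldI, (1.12) p.179, (1.81) p.195 (bookkeeping)] -/
theorem pinChi182_regions : (σ.pinChi182 δ').Ω = σ.Ω ∧ (σ.pinChi182 δ').Zpp = σ.Zpp ∧ (σ.pinChi182 δ').Z = σ.Z ∧ (σ.pinChi182 δ').Λ = σ.Λ ∧
    (σ.pinChi182 δ').OmT = σ.OmT ∧ (σ.pinChi182 δ').ΩppT2 = σ.ΩppT2 := ⟨rfl, rfl, rfl, rfl, rfl, rfl⟩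

/-- The pin keeps the cube sides, cube families and deviation letters (`rfl`). [cite: Balaban1989LargeFieldI, (1.88)–(1.90) pp.197–198 (bookkeeping)] -/
theorem pinChi182_cubes : (σ.pinChi182 δ').sh = σ.sh ∧ (σ.pinChi182 δ').sk = σ.sk ∧ (σ.pinChi182 δ').Xhalf = σ.Xhalf ∧ (σ.pinChi182 δ').XH = σ.XH ∧
    (σ.pinChi182 δ').XΩ4 = σ.XΩ4 ∧ (σ.pinChi182 δ').boxOf = σ.boxOf ∧ (σ.pinChi182 δ').dev0 = σ.dev0 ∧ (σ.pinChi182 δ').devV'' = σ.devV'' ∧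
    (σ.pinChi182 δ').dev97 = σ.dev97 := ⟨rfl, rfl, rfl, rfl, rfl, rfl, rfl, rfl, rfl⟩

/-- The pin keeps print's numbers (`rfl`). [cite: Balaban1989LargeFieldI, (1.80) p.195, pp.199–200 (bookkeeping)] -/
theorem pinChi182_numbers : (σ.pinChi182 δ').β = σ.β ∧ (σ.pinChi182 δ').L₀ = σ.L₀ ∧ (σ.pinChi182 δ').α = σ.α ∧ (σ.pinChi182 δ').δ = σ.δ ∧
    (σ.pinChi182 δ').B₃ = σ.B₃ ∧ (σ.pinChi182 δ').B₅ = σ.B₅ ∧ (σ.pinChi182 δ').M = σ.M ∧ (σ.pinChi182 δ').O1 = σ.O1 ∧ (σ.pinChi182 δ').dist = σ.dist :=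
  ⟨rfl, rfl, rfl, rfl, rfl, rfl, rfl, rfl, rfl⟩

/-- **THE PINNED (1.82) FUNCTION, UNFOLDED**: `χ′(B′)` iff `|B′(b)| < δ′` on every bond of `𝔹₀` at every scale (p29's `chiPrime182std_iff`). [cite: Balaban1989LargeFieldI, (1.82) p.196] -/
theorem pinChi182_chiP_iff (B' : (j : ℕ) → VecField (F.P K) j (EuclideanSpace ℝ (Fin (N ^ 2 - 1)))) :
    (σ.pinChi182 δ').chiP B' ↔ ∀ j, ∀ b ∈ bondsB0 σ.Ω σ.Zpp σ.Z σ.Λ σ.ΩppT2 σ.h σ.k j, ‖B' j b‖ < δ' := Iff.rfl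

/-- At the zero fluctuation variable `B′ = 0` the pinned `χ′` holds as soon as `δ′ > 0` (`|0| = 0`). [cite: Balaban1989LargeFieldI, (1.82) p.196 (bookkeeping witness)] -/
theorem chiP_pinChi182_zero (hδ : 0 < δ') : (σ.pinChi182 δ').chiP (fun _ _ => (0 : EuclideanSpace ℝ (Fin (N ^ 2 - 1)))) := by
  rw [pinChi182_chiP_iff]
  intro j b _
  show ‖(0 : EuclideanSpace ℝ (Fin (N ^ 2 - 1)))‖ < δ'
  rw [norm_zero]
  exact hδ

end Pin

section PinAtRecord

variable {F : T4Family} {N : ℕ} [NeZero N] (θ : Stage9Params F N) (P : B12.RunParams) (σ : Sit189 F N P.K) (δ' : ℝ)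

/-- **ALL FOUR REMAINING FUNCTIONS OF (1.89) CONCRETE AT THE RECORD** (the χ′-pinned situation; r11's `new189_iff_chart` ∕ module 4's `new189_D189OfRecord_iff` by name,
`σ.h ≤ σ.k`): `new189` at the pinned letters ⟺ [III] (2.17) `χ_k(Ω_k^{∼4}) = 1` ∧ (1.75) `χ_{k,Λ}` ∧ (1.88) `χ_{h,1/2} = 1` at def-R's background of record ∧ (1.82)
`|B′(b)| < δ′` on the bonds of `𝔹₀` — NO letter in the antecedent of the (1.80)∕(1.89) displays. [cite: Balaban1989LargeFieldI, (1.89) p.198, (1.75) p.193, (1.82) p.196, (1.88) p.197; Balaban1988Convergent, (2.17) p.257] -/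
theorem new189_D189OfRecord_pinChi182_iff (hhk : σ.h ≤ σ.k) (U : MSField (F.P P.K) (SU N) × ((j : ℕ) → VecField (F.P P.K) j (EuclideanSpace ℝ (Fin (N ^ 2 - 1))))) :
    new189 (D189OfRecord θ P (σ.pinChi182 δ')) U ↔
      chi217 (bgOfRecord (avOfRecord F N P.K) {U | PlaqSmall (θ.ν.εreg * (F.P P.K).eta σ.k ^ 2) U}) θ.ν.M₁ σ.XΩ4
          (fun a => plaqInside (cubeEnl (F.P P.K) σ.sk a 1)) (fun a => cubeEnl (F.P P.K) σ.sk a 4) (epsOfRecord θ.ν (gOfRecord₁₀ F N θ P) σ.k) σ.k (U.1 σ.k) = 1 ∧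
      chi175std (bgOfRecord (avOfRecord F N P.K) {U | PlaqSmall (θ.ν.εreg * (F.P P.K).eta σ.k ^ 2) U}) θ.ν.M₁ σ.Z σ.Λ σ.k σ.Ω
          (epsOfRecord θ.ν (gOfRecord₁₀ F N θ P) σ.k) ((F.P P.K).eta σ.k) (U.1 σ.k) ∧
      chiHalf (bgOfRecord (avOfRecord F N P.K) {U | PlaqSmall (θ.ν.εreg * (F.P P.K).eta σ.k ^ 2) U}) θ.ν.M₁ σ.Xhalf
          (fun a => plaqInside (cubeEnl (F.P P.K) σ.sh a 1)) (fun a => cubeEnl (F.P P.K) σ.sh a 4) (epsOfRecord θ.ν (gOfRecord₁₀ F N θ P)) σ.h σ.ΩppT2 (U.1 σ.h) = 1 ∧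
      (∀ j, ∀ b ∈ bondsB0 σ.Ω σ.Zpp σ.Z σ.Λ σ.ΩppT2 σ.h σ.k j, ‖U.2 j b‖ < δ') :=
  new189_D189OfRecord_iff θ P (σ.pinChi182 δ') hhk U

/-- **AFTER THE PIN THE (1.80)∕(1.89) BINDERS ARE NEVER VACUOUS**: with positive thresholds `ε_k`, `ε_h`, `εreg` and `δ′ > 0` the antecedent HOLDS at `(V, B′) = (1, 0)`
(`σ.h ≤ σ.k`). [cite: Balaban1989LargeFieldI, (1.89) p.198, (1.82) p.196 (bookkeeping witness)] -/
theorem new189_D189OfRecord_pinChi182_one_zero (hhk : σ.h ≤ σ.k) (hreg : 0 < θ.ν.εreg) (hεk : 0 < epsOfRecord θ.ν (gOfRecord₁₀ F N θ P) σ.k)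
    (hεh : 0 < epsOfRecord θ.ν (gOfRecord₁₀ F N θ P) σ.h) (hδ : 0 < δ') :
    new189 (D189OfRecord θ P (σ.pinChi182 δ')) ((1 : MSField (F.P P.K) (SU N)), fun _ _ => (0 : EuclideanSpace ℝ (Fin (N ^ 2 - 1)))) :=
  (new189_D189OfRecord_one_iff θ P (σ.pinChi182 δ') hhk hreg hεk hεh _).2 (chiP_pinChi182_zero σ δ' hδ)

/-- … so the antecedent is satisfiable, [cite: Balaban1989LargeFieldI, (1.89) p.198 (bookkeeping witness)] -/
theorem exists_new189_D189OfRecord_pinChi182 (hhk : σ.h ≤ σ.k) (hreg : 0 < θ.ν.εreg) (hεk : 0 < epsOfRecord θ.ν (gOfRecord₁₀ F N θ P) σ.k)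
    (hεh : 0 < epsOfRecord θ.ν (gOfRecord₁₀ F N θ P) σ.h) (hδ : 0 < δ') : ∃ U, new189 (D189OfRecord θ P (σ.pinChi182 δ')) U :=
  ⟨_, new189_D189OfRecord_pinChi182_one_zero θ P σ δ' hhk hreg hεk hεh hδ⟩

/-- … and dag-n12-d's junk certificate (`∀ U, ¬ new189 …`) CANNOT be reproduced by any situation carrying print's `χ′` with `δ′ > 0`. [cite: Balaban1989LargeFieldI, (1.89) p.198, (1.82) p.196 (bookkeeping census)] -/
theorem not_forall_not_new189_pinChi182 (hhk : σ.h ≤ σ.k) (hreg : 0 < θ.ν.εreg) (hεk : 0 < epsOfRecord θ.ν (gOfRecord₁₀ F N θ P) σ.k)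
    (hεh : 0 < epsOfRecord θ.ν (gOfRecord₁₀ F N θ P) σ.h) (hδ : 0 < δ') : ¬ ∀ U, ¬ new189 (D189OfRecord θ P (σ.pinChi182 δ')) U :=
  fun h => h _ (new189_D189OfRecord_pinChi182_one_zero θ P σ δ' hhk hreg hεk hεh hδ)

end PinAtRecord

section Layer

variable {F : T4Family} {N : ℕ} [NeZero N]

/-- **THE RESIDUAL [IV] LAYER WITH THE (1.89) LETTERS PINNED TO THE RECORD'S OBJECTS INCLUDING `χ′`**: module 4's `ResidW.pinD189` at the χ′-pinned situations, with
`δ′_k := deltaPrimeOfRecord θ P p₁ (σ P).k` — the record's `A₁` and coupling `g_k` at the situation's top level (print's exponent `p₁` a parameter).  Data, no law.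
[cite: Balaban1989LargeFieldI, (1.89) p.198, (1.82) p.196, p.183] -/
def _root_.Literature.MathematicalPhysics.QuantumFieldTheory.Balaban1983to89.Node00.ResidW.pinD189χ (lam : ResidW F N) (θ : Stage9Params F N)
    (σ : ∀ P : B12.RunParams, Sit189 F N P.K) (p₁ : ℕ) : ResidW F N :=
  lam.pinD189 θ (fun P => (σ P).pinChi182 (deltaPrimeOfRecord F N θ P p₁ (σ P).k))

variable (lam : ResidW F N) (θ : Stage9Params F N) (σ : ∀ P : B12.RunParams, Sit189 F N P.K) (p₁ : ℕ)

/-- The χ′-pinned layer IS module 4's D189 pin at the χ′-pinned situations (`rfl`). [cite: Balaban1989LargeFieldI, (1.89) p.198 (bookkeeping)] -/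
theorem pinD189χ_eq : lam.pinD189χ θ σ p₁ = lam.pinD189 θ (fun P => (σ P).pinChi182 (deltaPrimeOfRecord F N θ P p₁ (σ P).k)) := rfl

/-- The pin keeps the step selector, the Proposition-1 carrier and the (1.100) data (`rfl` ×3). [cite: Balaban1989LargeFieldI, (0.2) p.176, Prop. 1 p.194, (1.100) p.201 (bookkeeping)] -/
theorem pinD189χ_kSel_LF_D1100 : (lam.pinD189χ θ σ p₁).kSel = lam.kSel ∧ (lam.pinD189χ θ σ p₁).LF = lam.LF ∧ (lam.pinD189χ θ σ p₁).D1100 = lam.D1100 :=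
  ⟨rfl, rfl, rfl⟩

/-- The pinned (1.89) letters at run `P` (`rfl`). [cite: Balaban1989LargeFieldI, (1.89) p.198 (bookkeeping)] -/
theorem pinD189χ_D189 (P : B12.RunParams) :
    (lam.pinD189χ θ σ p₁).D189 P = D189OfRecord θ P ((σ P).pinChi182 (deltaPrimeOfRecord F N θ P p₁ (σ P).k)) := rfl

/-- The χ′-pin commutes with module 2's (1.100) pin (`rfl`). [cite: Balaban1989LargeFieldI, (1.89) p.198, (1.100) p.201 (bookkeeping)] -/
theorem pinD189χ_pinRPrime_comm : (lam.pinD189χ θ σ p₁).pinRPrime θ = (lam.pinRPrime θ).pinD189χ θ σ p₁ := rfl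

variable (F N) in
/-- **A2 — χ′-pinned doubly pinned layers EXIST** for every parameter, situation family and exponent. [cite: Balaban1989LargeFieldI, (1.89) p.198, (1.100) p.201 (bookkeeping witness)] -/
theorem exists_residW_pinD189χ_pinRPrime (θ : Stage9Params F N) (σ : ∀ P : B12.RunParams, Sit189 F N P.K) (p₁ : ℕ) :
    ∃ lam : ResidW F N, (lam.pinD189χ θ σ p₁).pinRPrime θ = lam :=
  let ⟨lam₀⟩ := nonempty_residW F N
  ⟨(lam₀.pinD189χ θ σ p₁).pinRPrime θ, rfl⟩

variable {θ} in
/-- **AT ADMISSIBLE PARAMETERS IN THE WINDOW THE χ′-PINNED (1.80)∕(1.89) BINDERS ARE CONTENTFUL**: for a run whose history lies in `]0, γ]` up to `n` (`γ < 1`), `A₁ > 0`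
(the Stage-12 sign `Pos₁₂`; a hypothesis on the Stage-9 part here) and a situation with `σ.h ≤ σ.k ≤ n`, the pinned antecedent holds at `(1, 0)` — every sign
input (`εreg`, `ε_h`, `ε_k`, `δ′_k`) read off admissibility and the window. [cite: Balaban1989LargeFieldI, (1.89) p.198, (1.82) p.196, p.183; Balaban1988Convergent, (2.4) p.255, (2.12) p.256] -/
theorem new189_pinD189χ_one_zero_of_admissible (hθ : θ.Admissible) (hγ1 : θ.γ < 1) (hA₁ : 0 < θ.A₁) (P : B12.RunParams) {n : ℕ}
    (hI : Step.InInterval θ.γ n (gOfRecord₁₀ F N θ P)) (hhk : (σ P).h ≤ (σ P).k) (hkn : (σ P).k ≤ n) :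
    new189 ((lam.pinD189χ θ σ p₁).D189 P) ((1 : MSField (F.P P.K) (SU N)), fun _ _ => (0 : EuclideanSpace ℝ (Fin (N ^ 2 - 1)))) :=
  new189_D189OfRecord_pinChi182_one_zero θ P (σ P) _ hhk hθ.1.1.2.2.1
    (B15Claim189FlowAtRecord.epsOfRecord₁₀_pos_of_admissible hθ hγ1 P hI (σ P).k hkn)
    (B15Claim189FlowAtRecord.epsOfRecord₁₀_pos_of_admissible hθ hγ1 P hI (σ P).h (hhk.trans hkn))
    (deltaPrimeOfRecord_pos_of_inInterval θ P p₁ hA₁ hγ1 hI hkn)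

end Layer

end B15Claim189PinNonVacuity

end Literature.MathematicalPhysics.QuantumFieldTheory.Balaban1983to89

end
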